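import Summits.QuantumFields.YangMills.Theorems.ColdStartUniversalityLatticeLangevinDossSussmannFlowSecondOrder
import Summits.QuantumFields.YangMills.Theorems.ColdStartUniversalityLatticeLangevinDossSussmannChainRule
import HarnessLib

/-!
# Route `ColdStartUniversality` (fixed-cut-off SZZ dynamics; Doss–Sussmann smoothing programme, file 9):
# ★★★ `P_t(C²) ⊂ C²` — THE SZZ SEMIGROUP PRESERVES `C²` CYLINDER FUNCTIONS (every `L`, `β`, `t`)

Helper file (seat `ym-line-csu-p1`, g24).  ★★★ `markovTransition_contDiff_two`: as `markovTransition_contDiff_one` (file 5)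
one order higher — for every `C²` function `f` of the ambient matrix coordinates there is a `C²` function `g` with
`𝔼 f(coords U^x_t) = g(coords x)` for every `x ∈ SU(2)^E`.  With `C²` the generator `𝓛` can be applied to `P_t f`: this is
the regularity input for backward Kolmogorov / Bakry–Émery `Γ₂` at fixed cut-off (memos g22 §3(c), g23 §3, g24 §3).
Proof: as in file 5, with the SECOND-derivative bound of the Doss–Sussmann flow UNIFORM in the Brownian path (file 7,
jet-system Grönwall) and the iterable abstract differentiation step (file 8) applied twice; the second derivative of the
integrand is computed by the product rule for `∘L` (`HasFDerivAt.clm_comp`) and bounded by `‖compL‖ ≤ 1`.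
THEOREMS ONLY, no sorry.  HONEST FRAMING: fixed-cut-off regularity; constants not explicit; nothing K-uniform; no crux,
rung or summit statement is proved; the Yang–Mills mass gap is NOT proved.
-/

set_option autoImplicit false

noncomputable section

namespace Summit.QuantumFields.YangMills.Theorems.ColdStartUniversality

open MeasureTheory Finset Filter Set Metric Function unitInterval
open scoped NNReal Matrix Topology
open Literature.MathematicalPhysics.QuantumFieldTheory Literature.Analysis.ODE
open Literature.MathematicalPhysics.QuantumLattice (fundamentalRep fundamentalLatticeRep continuous_fundamentalRep
  fundamentalRep_mem_unitaryGroup)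

variable {L : ℕ}

/-- A function continuous on `U` is bounded on every closed ball inside `U` (proper domain). [folklore] -/
theorem exists_bound_on_closedBall {X Y : Type*} [NormedAddCommGroup X] [ProperSpace X] [SeminormedAddCommGroup Y]
    {g : X → Y} {U : Set X} {M₀ : X} {r : ℝ} (hg : ContinuousOn g U) (hsub : closedBall M₀ r ⊆ U) :
    ∃ C : ℝ, 0 ≤ C ∧ ∀ M ∈ closedBall M₀ r, ‖g M‖ ≤ C := by
  obtain ⟨C, hC⟩ := (isCompact_closedBall M₀ r).exists_bound_of_continuousOn (hg.mono hsub)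
  exact ⟨max C 0, le_max_right _ _, fun M hM => (hC M hM).trans (le_max_left _ _)⟩

/-- `exists_smooth_retraction` restated in the `ρ`/`Fin (fundamentalLatticeRep 2).N` coordinates used by the flow files
(definitionally the same statement). [folklore] -/
theorem exists_smooth_retraction_rho (L : ℕ) [NeZero L] :
    ∃ (R : (Edge 3 L → Fin (fundamentalLatticeRep 2).N → Fin (fundamentalLatticeRep 2).N → ℂ) →
        GaugeConfig 3 L (Matrix.specialUnitaryGroup (Fin 2) ℂ))
      (U₀ : Set (Edge 3 L → Fin (fundamentalLatticeRep 2).N → Fin (fundamentalLatticeRep 2).N → ℂ))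
      (χ : (Edge 3 L → Fin (fundamentalLatticeRep 2).N → Fin (fundamentalLatticeRep 2).N → ℂ) → ℝ),
      IsOpen U₀ ∧
      (∀ x : GaugeConfig 3 L (Matrix.specialUnitaryGroup (Fin 2) ℂ),
        (fun (e : Edge 3 L) (k l : Fin (fundamentalLatticeRep 2).N) => (fundamentalLatticeRep 2).ρ (x e) k l) ∈ U₀) ∧
      (∀ x : GaugeConfig 3 L (Matrix.specialUnitaryGroup (Fin 2) ℂ),
        R (fun (e : Edge 3 L) (k l : Fin (fundamentalLatticeRep 2).N) => (fundamentalLatticeRep 2).ρ (x e) k l) = x) ∧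
      ContDiffOn ℝ (⊤ : ℕ∞) (fun M => fun (e : Edge 3 L) (k l : Fin (fundamentalLatticeRep 2).N) =>
        (fundamentalLatticeRep 2).ρ (R M e) k l) U₀ ∧
      ContDiff ℝ (⊤ : ℕ∞) χ ∧
      (∀ x : GaugeConfig 3 L (Matrix.specialUnitaryGroup (Fin 2) ℂ),
        χ (fun (e : Edge 3 L) (k l : Fin (fundamentalLatticeRep 2).N) => (fundamentalLatticeRep 2).ρ (x e) k l) = 1) ∧
      (∀ M, M ∉ U₀ → χ =ᶠ[𝓝 M] fun _ => 0) :=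
  exists_smooth_retraction L

/-- **Per-sample regularity package for the integrand.**  For `φ(M) = f(Lp(Φ₁(cR M)))` with `f ∈ C²` (derivative
bounds `Cf`, `Cf2` on the ball of radius `2(1+D)`), `Lp` linear with `‖Lp‖ ≤ 2`, `Φ₁ ∈ C^∞` with `‖DΦ₁‖ ≤ E₁`,
`‖D²Φ₁‖ ≤ E₂`, `‖Φ₁ y‖ ≤ ‖y‖ + D`, and `cR ∈ C^∞(U₀)` with `‖cR M‖ ≤ 1`: `φ` is `C²` on `U₀` with
`‖Dφ(M)‖ ≤ Cf·2E₁‖DcR(M)‖` and `‖D²φ(M)‖ ≤ Cf2(2E₁‖DcR M‖)² + Cf(2E₂‖DcR M‖² + 2E₁‖D²cR M‖)` — bounds in which the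
sample `ω` enters only through `E₁, E₂, D` (uniform by files 2 and 7). [folklore] -/
theorem integrand_regularity {X : Type*} [NormedAddCommGroup X] [NormedSpace ℝ X]
    {f : X → ℝ} (hf : ContDiff ℝ 2 f) {D Cf Cf2 E₁ E₂ : ℝ} (hCf : 0 ≤ Cf) (hCf2 : 0 ≤ Cf2)
    (hCfb : ∀ z ∈ closedBall (0 : X) (2 * (1 + D)), ‖fderiv ℝ f z‖ ≤ Cf)
    (hCf2b : ∀ z ∈ closedBall (0 : X) (2 * (1 + D)), ‖fderiv ℝ (fderiv ℝ f) z‖ ≤ Cf2)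
    (Lp : X →L[ℝ] X) (hLp : ‖Lp‖ ≤ 2) {Φ₁ : X → X} (hΦ₁ : ContDiff ℝ (⊤ : ℕ∞) Φ₁)
    (hΦ₁b : ∀ y, ‖fderiv ℝ Φ₁ y‖ ≤ E₁) (hΦ₁b2 : ∀ y, ‖fderiv ℝ (fderiv ℝ Φ₁) y‖ ≤ E₂)
    (hΦ₁n : ∀ y, ‖Φ₁ y‖ ≤ ‖y‖ + D)
    {cR : X → X} {U₀ : Set X} (hU₀ : IsOpen U₀) (hcRs : ContDiffOn ℝ (⊤ : ℕ∞) cR U₀) (hcR1 : ∀ M, ‖cR M‖ ≤ 1) :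
    ContDiffOn ℝ 2 (fun M => f (Lp (Φ₁ (cR M)))) U₀ ∧
    (∀ M ∈ U₀, ‖fderiv ℝ (fun M => f (Lp (Φ₁ (cR M)))) M‖ ≤ Cf * (2 * E₁ * ‖fderiv ℝ cR M‖)) ∧
    (∀ M ∈ U₀, ‖fderiv ℝ (fderiv ℝ (fun M => f (Lp (Φ₁ (cR M))))) M‖ ≤
      Cf2 * (2 * E₁ * ‖fderiv ℝ cR M‖) ^ 2 + Cf * (2 * E₂ * ‖fderiv ℝ cR M‖ ^ 2 + 2 * E₁ * ‖fderiv ℝ (fderiv ℝ cR) M‖)) := by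
  have hΦ₁2 : ContDiff ℝ 2 Φ₁ := contDiff_infty.1 hΦ₁ 2
  have hΦ₁d : Differentiable ℝ Φ₁ := hΦ₁2.differentiable two_ne_zero
  have hcRs2 : ContDiffOn ℝ 2 cR U₀ := contDiffOn_infty.1 hcRs 2
  have hcRd : ∀ M ∈ U₀, DifferentiableAt ℝ cR M := fun M hM =>
    (hcRs2.differentiableOn two_ne_zero).differentiableAt (hU₀.mem_nhds hM)
  -- `Θ = Lp ∘ Φ₁`
  have hΘs : ContDiff ℝ 2 (fun y => Lp (Φ₁ y)) := Lp.contDiff.comp hΦ₁2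
  have hΘd : Differentiable ℝ (fun y => Lp (Φ₁ y)) := hΘs.differentiable two_ne_zero
  have hΘ1 : ∀ y, ‖fderiv ℝ (fun y => Lp (Φ₁ y)) y‖ ≤ 2 * E₁ := fun y => by
    have h := norm_fderiv_comp_le' (g := fun z => Lp z) (h := Φ₁) (x := y) Lp.differentiableAt (hΦ₁d y)
    rw [Lp.fderiv] at h
    exact h.trans (mul_le_mul hLp (hΦ₁b y) (norm_nonneg (fderiv ℝ Φ₁ y)) (by norm_num))
  have hΘ2 : ∀ y, ‖fderiv ℝ (fderiv ℝ (fun y => Lp (Φ₁ y))) y‖ ≤ 2 * E₂ := fun y =>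
    (norm_fderiv_fderiv_clm_comp_le Lp (hΦ₁2.contDiffAt)).trans
      (mul_le_mul hLp (hΦ₁b2 y) (norm_nonneg (fderiv ℝ (fderiv ℝ Φ₁) y)) (by norm_num))
  have hrange : ∀ M, Lp (Φ₁ (cR M)) ∈ closedBall (0 : X) (2 * (1 + D)) := fun M => by
    refine mem_closedBall_zero_iff.2 ?_
    calc ‖Lp (Φ₁ (cR M))‖ ≤ ‖Lp‖ * ‖Φ₁ (cR M)‖ := Lp.le_opNorm _
      _ ≤ 2 * (1 + D) := mul_le_mul hLp ((hΦ₁n _).trans (by linarith [hcR1 M])) (norm_nonneg _) (by norm_num)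
  have heq : (fun M => f (Lp (Φ₁ (cR M)))) = f ∘ ((fun y => Lp (Φ₁ y)) ∘ cR) := rfl
  refine ⟨?_, fun M hM => ?_, fun M hM => ?_⟩
  · rw [heq]; exact hf.comp_contDiffOn (hΘs.comp_contDiffOn hcRs2)
  · rw [heq]
    have hin : DifferentiableAt ℝ ((fun y => Lp (Φ₁ y)) ∘ cR) M := (hΘd _).comp M (hcRd M hM)
    refine (norm_fderiv_comp_le' (hf.differentiable two_ne_zero _) hin).trans ?_
    refine mul_le_mul (hCfb _ (hrange M)) ?_ (norm_nonneg _) hCf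
    exact (norm_fderiv_comp_le' (hΘd _) (hcRd M hM)).trans
      (mul_le_mul_of_nonneg_right (hΘ1 _) (norm_nonneg (fderiv ℝ cR M)))
  · rw [heq]
    have hin : ContDiffAt ℝ 2 ((fun y => Lp (Φ₁ y)) ∘ cR) M :=
      hΘs.contDiffAt.comp M (hcRs2.contDiffAt (hU₀.mem_nhds hM))
    have hin1 : ‖fderiv ℝ ((fun y => Lp (Φ₁ y)) ∘ cR) M‖ ≤ 2 * E₁ * ‖fderiv ℝ cR M‖ :=
      (norm_fderiv_comp_le' (hΘd _) (hcRd M hM)).trans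
        (mul_le_mul_of_nonneg_right (hΘ1 _) (norm_nonneg (fderiv ℝ cR M)))
    have hin2 : ‖fderiv ℝ (fderiv ℝ ((fun y => Lp (Φ₁ y)) ∘ cR)) M‖ ≤
        2 * E₂ * ‖fderiv ℝ cR M‖ ^ 2 + 2 * E₁ * ‖fderiv ℝ (fderiv ℝ cR) M‖ :=
      (norm_fderiv_fderiv_comp_le hΘs.contDiffAt (hcRs2.contDiffAt (hU₀.mem_nhds hM))).trans
        (add_le_add (mul_le_mul_of_nonneg_right (hΘ2 _) (sq_nonneg ‖fderiv ℝ cR M‖))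
          (mul_le_mul_of_nonneg_right (hΘ1 _) (norm_nonneg (fderiv ℝ (fderiv ℝ cR) M))))
    refine (norm_fderiv_fderiv_comp_le (g := f) hf.contDiffAt hin).trans (add_le_add ?_ ?_)
    · exact mul_le_mul (hCf2b _ (hrange M))
        (pow_le_pow_left₀ (norm_nonneg (fderiv ℝ ((fun y => Lp (Φ₁ y)) ∘ cR) M)) hin1 2) (sq_nonneg _) hCf2
    · exact mul_le_mul (hCfb _ (hrange M)) hin2
        (norm_nonneg (fderiv ℝ (fderiv ℝ ((fun y => Lp (Φ₁ y)) ∘ cR)) M)) hCf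
set_option maxHeartbeats 400000 in
/-- ★★★ **`P_t(C²) ⊂ C²` for the SZZ dynamics at fixed cut-off.**  Let `B` (free, `β = 0`) and `U` (coupling `β`) be
regular solution families of the SZZ lattice Langevin SDE on `SU(2)^E` driven by the same flat noise, `t ≥ 0`, and
`f` a `C²` function of the ambient matrix coordinates.  Then there is a `C²` function `g` of the ambient coordinates with
`𝔼 f(coords U^x_t) = g(coords x)` for every group configuration `x`. [folklore] -/
theorem markovTransition_contDiff_two [NeZero L] (β : ℝ)
    {Ω : Type} [MeasurableSpace Ω] {P : Measure Ω} [IsProbabilityMeasure P]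
    {W : ℝ≥0 → Ω → (Edge 3 L × NoiseIdx 2 → ℝ)} (hW : IsFlatBrownian W P)
    (B U : GaugeConfig 3 L (Matrix.specialUnitaryGroup (Fin 2) ℂ) → ℝ≥0 → Ω →
      GaugeConfig 3 L (Matrix.specialUnitaryGroup (Fin 2) ℂ))
    (hB : ∀ x, (∀ ω, B x 0 ω = x) ∧
      (latticeLangevinDynamics (fundamentalLatticeRep 2) 0).IsSolution (fundamentalRep (Fin 2)) hW.natFiltration P W (B x))
    (hBm : ∀ i : ℝ≥0, Measurable[@Prod.instMeasurableSpace (Set.Iic i)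
        (GaugeConfig 3 L (Matrix.specialUnitaryGroup (Fin 2) ℂ) × Ω) inferInstance
        (@Prod.instMeasurableSpace (GaugeConfig 3 L (Matrix.specialUnitaryGroup (Fin 2) ℂ)) Ω inferInstance
          (hW.natFiltration i))]
      (fun q : Set.Iic i × (GaugeConfig 3 L (Matrix.specialUnitaryGroup (Fin 2) ℂ) × Ω) => B q.2.1 q.1 q.2.2))
    (hU : ∀ x, (∀ ω, U x 0 ω = x) ∧
      (latticeLangevinDynamics (fundamentalLatticeRep 2) β).IsSolution (fundamentalRep (Fin 2)) hW.natFiltration P W (U x))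
    (hUm : ∀ i : ℝ≥0, Measurable[@Prod.instMeasurableSpace (Set.Iic i)
        (GaugeConfig 3 L (Matrix.specialUnitaryGroup (Fin 2) ℂ) × Ω) inferInstance
        (@Prod.instMeasurableSpace (GaugeConfig 3 L (Matrix.specialUnitaryGroup (Fin 2) ℂ)) Ω inferInstance
          (hW.natFiltration i))]
      (fun q : Set.Iic i × (GaugeConfig 3 L (Matrix.specialUnitaryGroup (Fin 2) ℂ) × Ω) => U q.2.1 q.1 q.2.2))
    (t : ℝ≥0) {f : (Edge 3 L → Fin (fundamentalLatticeRep 2).N → Fin (fundamentalLatticeRep 2).N → ℂ) → ℝ}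
    (hf : ContDiff ℝ 2 f) :
    ∃ g : (Edge 3 L → Fin (fundamentalLatticeRep 2).N → Fin (fundamentalLatticeRep 2).N → ℂ) → ℝ,
      ContDiff ℝ 2 g ∧
      ∀ x : GaugeConfig 3 L (Matrix.specialUnitaryGroup (Fin 2) ℂ),
        ∫ ω, f (fun (e : Edge 3 L) (k l : Fin (fundamentalLatticeRep 2).N) =>
            (fundamentalLatticeRep 2).ρ (U x t ω e) k l) ∂P =
          g (fun (e : Edge 3 L) (k l : Fin (fundamentalLatticeRep 2).N) => (fundamentalLatticeRep 2).ρ (x e) k l) := by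
  classical
  let Cfg : Type := Edge 3 L → Fin (fundamentalLatticeRep 2).N → Fin (fundamentalLatticeRep 2).N → ℂ
  obtain ⟨coords, hcoords⟩ : ∃ coords : GaugeConfig 3 L (Matrix.specialUnitaryGroup (Fin 2) ℂ) → Cfg,
      coords = fun x e k l => (fundamentalLatticeRep 2).ρ (x e) k l := ⟨_, rfl⟩
  have hcoords_c : Continuous coords := by rw [hcoords]; exact continuous_coordsRho (L := L)
  have hcoords1 : ∀ x, ‖coords x‖ ≤ 1 := fun x => by rw [hcoords]; exact norm_frame_config_le_one (L := L) x
  have hmU : ∀ x u, Measurable (U x u) := fun x u => ((hU x).2.adapted u).mono (hW.natFiltration.le u) le_rfl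
  -- (1) tamed field, (2) retraction
  obtain ⟨G, hG, hGF, K, hK0, hK1, hK2, hK3⟩ := exists_tamed_dossSussmannField₂ (L := L) β
  have hGc : Continuous G := hG.continuous
  obtain ⟨R, U₀, χ, hU₀, hxU₀', hRx', hRs', hχs, hχx', hχ0⟩ := exists_smooth_retraction_rho L
  have hxU₀ : ∀ x, coords x ∈ U₀ := fun x => by rw [hcoords]; exact hxU₀' x
  have hRx : ∀ x, R (coords x) = x := fun x => by rw [hcoords]; exact hRx' x
  have hRs : ContDiffOn ℝ (⊤ : ℕ∞) (fun M => coords (R M)) U₀ := by rw [hcoords]; exact hRs'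
  have hχx : ∀ x, χ (coords x) = 1 := fun x => by rw [hcoords]; exact hχx' x
  set T : ℝ := (t : ℝ) with hTdef
  have hT0 : 0 ≤ T := t.2
  -- (3) frame paths
  obtain ⟨craw, hcraw⟩ : ∃ craw : Ω → I → Cfg,
      craw = fun ω (τ : I) e k l => (fundamentalLatticeRep 2).ρ (B 1 (T * (τ : ℝ)).toNNReal ω e) k l := ⟨_, rfl⟩
  have hcraw1 : ∀ ω τ, ‖craw ω τ‖ ≤ 1 := fun ω τ => by
    rw [hcraw]; exact norm_frame_config_le_one (L := L) (fun e => B 1 (T * (τ : ℝ)).toNNReal ω e)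
  obtain ⟨c, hc⟩ : ∃ c : Ω → C(I, Cfg), c = fun ω =>
      if h : Continuous (craw ω) then ⟨craw ω, h⟩ else ContinuousMap.const I (craw ω 0) := ⟨_, rfl⟩
  have hc1 : ∀ ω τ, ‖c ω τ‖ ≤ 1 := by
    intro ω τ
    rw [hc]
    by_cases h : Continuous (craw ω)
    · simp only [h, dif_pos]; exact hcraw1 ω τ
    · simp only [h, dif_neg, not_false_eq_true, ContinuousMap.const_apply]; exact hcraw1 ω 0
  -- (4) flows, (5) left multiplications
  choose Φ hΦeq hΦuniq hΦs hΦder hΦdisp hΦder2 using fun ω =>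
    exists_dossSussmannFlow₂ hG hK0 hK1 hK2 hK3 hT0 (c ω) (hc1 ω)
  choose Lp hLp hLpn using fun ω =>
    (exists_leftMul_clm (L := L) (craw ω 1) : ∃ Lp : Cfg →L[ℝ] Cfg,
      (∀ V, Lp V = fun (e : Edge 3 L) (k l : Fin (fundamentalLatticeRep 2).N) =>
        (Matrix.of (craw ω 1 e) * Matrix.of (V e)) k l) ∧ ‖Lp‖ ≤ 2 * ‖craw ω 1‖)
  have hLp2 : ∀ ω, ‖Lp ω‖ ≤ 2 := fun ω =>
    calc ‖Lp ω‖ ≤ 2 * ‖craw ω 1‖ := hLpn ω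
      _ ≤ 2 * 1 := by gcongr; exact hcraw1 ω 1
      _ = 2 := by norm_num
  -- (6) the retraction in coordinates, the flow at time one, the integrand
  obtain ⟨cR, hcR⟩ : ∃ cR : Cfg → Cfg, cR = fun M => coords (R M) := ⟨_, rfl⟩
  have hcR1 : ∀ M, ‖cR M‖ ≤ 1 := fun M => by rw [hcR]; exact hcoords1 (R M)
  have hcRs : ContDiffOn ℝ (⊤ : ℕ∞) cR U₀ := by rw [hcR]; exact hRs
  have hcRc : ContinuousOn cR U₀ := hcRs.continuousOn
  have hcRd : ∀ M ∈ U₀, HasFDerivAt cR (fderiv ℝ cR M) M := fun M hM =>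
    ((hcRs.differentiableOn (by simp)).differentiableAt (hU₀.mem_nhds hM)).hasFDerivAt
  have hcRfc : ContinuousOn (fderiv ℝ cR) U₀ := hcRs.continuousOn_fderiv_of_isOpen hU₀ (by simp)
  obtain ⟨Φ1, hΦ1⟩ : ∃ Φ1 : Ω → Cfg → Cfg, Φ1 = fun ω y => Φ ω y 1 := ⟨_, rfl⟩
  have hΦ1s : ∀ ω, ContDiff ℝ (⊤ : ℕ∞) (Φ1 ω) := fun ω => by
    rw [hΦ1]; exact (ContinuousMap.evalCLM ℝ (1 : I) (M := Cfg)).contDiff.comp (hΦs ω)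
  have hΦ1d : ∀ ω, Differentiable ℝ (Φ1 ω) := fun ω => (hΦ1s ω).differentiable (by simp)
  have hΦ1fc : ∀ ω, Continuous (fderiv ℝ (Φ1 ω)) := fun ω => (hΦ1s ω).continuous_fderiv (by simp)
  have hΦ1b : ∀ ω y, ‖fderiv ℝ (Φ1 ω) y‖ ≤ Real.exp (T * K) := fun ω y => by
    have h := hΦder ω y 1
    rw [Set.Icc.coe_one, mul_one] at h
    rw [hΦ1]
    exact h
  have hΦ1n : ∀ ω y, ‖Φ1 ω y‖ ≤ ‖y‖ + T * K := fun ω y => by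
    have h := hΦdisp ω y 1
    simp only [Set.Icc.coe_one, mul_one] at h
    rw [hΦ1]
    calc ‖Φ ω y 1‖ = ‖(Φ ω y 1 - y) + y‖ := by rw [sub_add_cancel]
      _ ≤ ‖Φ ω y 1 - y‖ + ‖y‖ := norm_add_le _ _
      _ ≤ T * K + ‖y‖ := by gcongr
      _ = ‖y‖ + T * K := add_comm _ _
  obtain ⟨F, hF⟩ : ∃ F : Cfg → Ω → ℝ, F = fun M ω => f (Lp ω (Φ1 ω (cR M))) := ⟨_, rfl⟩
  -- the range of the inner point is bounded, uniformly in `ω`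
  have hrange : ∀ ω M, Lp ω (Φ1 ω (cR M)) ∈ closedBall (0 : Cfg) (2 * (1 + T * K)) := by
    intro ω M
    refine mem_closedBall_zero_iff.2 ?_
    calc ‖Lp ω (Φ1 ω (cR M))‖ ≤ ‖Lp ω‖ * ‖Φ1 ω (cR M)‖ := (Lp ω).le_opNorm _
      _ ≤ 2 * (1 + T * K) :=
          mul_le_mul (hLp2 ω) ((hΦ1n ω _).trans (by linarith [hcR1 M])) (norm_nonneg _) (by norm_num)
  obtain ⟨Cf, hCf⟩ := (isCompact_closedBall (0 : Cfg) (2 * (1 + T * K))).exists_bound_of_continuousOn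
    ((hf.continuous_fderiv two_ne_zero).continuousOn)
  obtain ⟨Cf0, hCf0⟩ := (isCompact_closedBall (0 : Cfg) (2 * (1 + T * K))).exists_bound_of_continuousOn
    (hf.continuous.continuousOn)
  have hCfnn : 0 ≤ Cf := (norm_nonneg _).trans (hCf _ (mem_closedBall_self (by positivity)))
  -- (7) the a.s. identity `f(coords U^{R M}_t) = F M`
  have hae : ∀ M, (fun ω => f (coords (U (R M) t ω))) =ᵐ[P] F M := by
    intro M
    filter_upwards [dossSussmann_flow_representation (L := L) β hGc hGF hW B U hB hBm hU hUm 1 (R M) hT0]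
      with ω hω
    obtain ⟨hcont, hrep⟩ := hω
    have hcω_cont : Continuous (craw ω) := by rw [hcraw]; exact hcont
    have hcω : c ω = ⟨craw ω, hcω_cont⟩ := by rw [hc]; exact dif_pos hcω_cont
    have huniq := hΦuniq ω
    rw [hcω] at huniq
    subst hcraw
    have key := hrep (Φ ω) huniq 1
    have ht1 : (T * ((1 : I) : ℝ)).toNNReal = t := by simp [hTdef]
    -- the start: `(ρ1)ᴴ ρ(R M) = coords (R M)`
    have hstart : (fun (e : Edge 3 L) (k l : Fin (fundamentalLatticeRep 2).N) =>
        (((fundamentalLatticeRep 2).ρ ((1 : GaugeConfig 3 L (Matrix.specialUnitaryGroup (Fin 2) ℂ)) e))ᴴ *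
          (fundamentalLatticeRep 2).ρ (R M e)) k l) = cR M := by
      rw [hcR, hcoords]; funext e k l
      have h1e : (1 : GaugeConfig 3 L (Matrix.specialUnitaryGroup (Fin 2) ℂ)) e = 1 := rfl
      show (((fundamentalLatticeRep 2).ρ ((1 : GaugeConfig 3 L (Matrix.specialUnitaryGroup (Fin 2) ℂ)) e))ᴴ *
          (fundamentalLatticeRep 2).ρ (R M e)) k l = (fundamentalLatticeRep 2).ρ (R M e) k l
      rw [h1e, map_one, Matrix.conjTranspose_one, Matrix.one_mul]
    rw [hstart] at key
    rw [hF]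
    show f (coords (U (R M) t ω)) = f (Lp ω (Φ1 ω (cR M)))
    congr 1
    rw [hLp ω, hΦ1, hcoords]
    funext e k l
    rw [← ht1]
    show ((fundamentalLatticeRep 2).ρ (U (R M) (T * ((1 : I) : ℝ)).toNNReal ω e)) k l = _
    rw [key e]
    rfl
  -- measurability and integrability of the integrand
  have hFmeas : ∀ M, AEStronglyMeasurable (F M) P := fun M =>
    (((hf.continuous.comp hcoords_c).measurable.comp (hmU (R M) t)).aestronglyMeasurable).congr (hae M)
  have hFbdd : ∀ M ω, ‖F M ω‖ ≤ Cf0 := fun M ω => by rw [hF]; exact hCf0 _ (hrange ω M)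
  have hFint : ∀ M, Integrable (F M) P := fun M =>
    Integrable.of_bound (hFmeas M) Cf0 (ae_of_all _ fun ω => hFbdd M ω)
  -- (8)–(9) per-sample regularity of the integrand, first and second order, uniform in `ω`
  have hΦ1b2 : ∀ ω y, ‖fderiv ℝ (fderiv ℝ (Φ1 ω)) y‖ ≤ Real.exp (T * K + T * K * Real.exp (T * K)) := fun ω y => by
    have h := hΦder2 ω y 1
    rw [Set.Icc.coe_one, mul_one] at h
    rw [hΦ1]
    exact h
  have hf1 : ContDiff ℝ 1 (fderiv ℝ f) := hf.fderiv_right (m := 1) le_rfl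
  obtain ⟨Cf2, hCf2⟩ := (isCompact_closedBall (0 : Cfg) (2 * (1 + T * K))).exists_bound_of_continuousOn
    (f := fderiv ℝ (fderiv ℝ f)) (hf1.continuous_fderiv one_ne_zero).continuousOn
  have hCf2nn : 0 ≤ Cf2 := (norm_nonneg _).trans (hCf2 _ (mem_closedBall_self (by positivity)))
  have hpkg := fun ω => integrand_regularity (X := Cfg) hf (D := T * K) hCfnn hCf2nn
    hCf hCf2 (Lp ω) (hLp2 ω) (hΦ1s ω) (hΦ1b ω) (hΦ1b2 ω) (hΦ1n ω) hU₀ hcRs hcR1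
  have hFφ : ∀ ω, (fun M => F M ω) = fun M => f (Lp ω (Φ1 ω (cR M))) := fun ω => by rw [hF]
  have hFs2 : ∀ ω, ContDiffOn ℝ 2 (fun M => F M ω) U₀ := fun ω => by rw [hFφ]; exact (hpkg ω).1
  have hFd1 : ∀ ω, ContDiffOn ℝ 1 (fderiv ℝ (fun M => F M ω)) U₀ := fun ω =>
    (hFs2 ω).fderiv_of_isOpen hU₀ (m := 1) le_rfl
  obtain ⟨F', hF'⟩ : ∃ F' : Cfg → Ω → (Cfg →L[ℝ] ℝ), F' = fun M ω => fderiv ℝ (fun M => F M ω) M := ⟨_, rfl⟩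
  obtain ⟨F'', hF''⟩ : ∃ F'' : Cfg → Ω → (Cfg →L[ℝ] (Cfg →L[ℝ] ℝ)),
      F'' = fun M ω => fderiv ℝ (fderiv ℝ (fun M => F M ω)) M := ⟨_, rfl⟩
  have hF'fun : ∀ ω, (fun M => F' M ω) = fderiv ℝ (fun M => F M ω) := fun ω => by funext M; rw [hF']
  have hF''fun : ∀ ω, (fun M => F'' M ω) = fderiv ℝ (fderiv ℝ (fun M => F M ω)) := fun ω => by
    funext M; rw [hF'']
  have hderiv : ∀ ω, ∀ M ∈ U₀, HasFDerivAt (fun M => F M ω) (F' M ω) M := fun ω M hM => by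
    rw [hF']
    exact (((hFs2 ω).differentiableOn two_ne_zero).differentiableAt (hU₀.mem_nhds hM)).hasFDerivAt
  have hderiv2 : ∀ ω, ∀ M ∈ U₀, HasFDerivAt (fun M => F' M ω) (F'' M ω) M := fun ω M hM => by
    rw [hF'fun, hF'']
    exact (((hFd1 ω).differentiableOn one_ne_zero).differentiableAt (hU₀.mem_nhds hM)).hasFDerivAt
  have hF'cont : ∀ ω, ContinuousOn (fun M => F' M ω) U₀ := fun ω => by
    rw [hF'fun]; exact (hFs2 ω).continuousOn_fderiv_of_isOpen hU₀ (by norm_num)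
  have hF''cont : ∀ ω, ContinuousOn (fun M => F'' M ω) U₀ := fun ω => by
    rw [hF''fun]; exact (hFd1 ω).continuousOn_fderiv_of_isOpen hU₀ le_rfl
  have hF'bound : ∀ ω, ∀ M ∈ U₀, ‖F' M ω‖ ≤ Cf * (2 * Real.exp (T * K) * ‖fderiv ℝ cR M‖) := fun ω M hM => by
    rw [hF']; simp only; rw [hFφ ω]; exact (hpkg ω).2.1 M hM
  have hF''bound : ∀ ω, ∀ M ∈ U₀, ‖F'' M ω‖ ≤
      Cf2 * (2 * Real.exp (T * K) * ‖fderiv ℝ cR M‖) ^ 2 +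
        Cf * (2 * Real.exp (T * K + T * K * Real.exp (T * K)) * ‖fderiv ℝ cR M‖ ^ 2 +
          2 * Real.exp (T * K) * ‖fderiv ℝ (fderiv ℝ cR) M‖) := fun ω M hM => by
    rw [hF'']; simp only; rw [hFφ ω]; exact (hpkg ω).2.2 M hM
  have hF'meas : ∀ M ∈ U₀, AEStronglyMeasurable (F' M) P := fun M hM =>
    aestronglyMeasurable_fderiv_param hFmeas fun ω => hderiv ω M hM
  have hcRs2 : ContDiffOn ℝ 2 cR U₀ := contDiffOn_infty.1 hcRs 2
  have hcRs1' : ContDiffOn ℝ 1 (fderiv ℝ cR) U₀ := hcRs2.fderiv_of_isOpen hU₀ (m := 1) le_rfl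
  have hcR''c : ContinuousOn (fderiv ℝ (fderiv ℝ cR)) U₀ := hcRs1'.continuousOn_fderiv_of_isOpen hU₀ le_rfl
  -- (10) differentiation under the expectation, twice
  have hbd1 : ∀ M₀ ∈ U₀, ∃ ε > 0, ∃ C : ℝ, ball M₀ ε ⊆ U₀ ∧ ∀ ω, ∀ M ∈ ball M₀ ε, ‖F' M ω‖ ≤ C := by
    intro M₀ hM₀
    obtain ⟨ε, hε, hball⟩ := Metric.isOpen_iff.1 hU₀ M₀ hM₀
    have hε2 : 0 < ε / 2 := half_pos hε
    have hcb : closedBall M₀ (ε / 2) ⊆ U₀ := (closedBall_subset_ball (half_lt_self hε)).trans hball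
    have hbU : ball M₀ (ε / 2) ⊆ U₀ := ball_subset_closedBall.trans hcb
    obtain ⟨CR, -, hCR⟩ := exists_bound_on_closedBall (g := fderiv ℝ cR) hcRfc hcb
    refine ⟨ε / 2, hε2, Cf * (2 * Real.exp (T * K) * CR), hbU, fun ω M hM => ?_⟩
    refine (hF'bound ω M (hbU hM)).trans ?_
    have := hCR M (ball_subset_closedBall hM)
    gcongr
  have hbd2 : ∀ M₀ ∈ U₀, ∃ ε > 0, ∃ C : ℝ, ball M₀ ε ⊆ U₀ ∧ ∀ ω, ∀ M ∈ ball M₀ ε, ‖F'' M ω‖ ≤ C := by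
    intro M₀ hM₀
    obtain ⟨ε, hε, hball⟩ := Metric.isOpen_iff.1 hU₀ M₀ hM₀
    have hε2 : 0 < ε / 2 := half_pos hε
    have hcb : closedBall M₀ (ε / 2) ⊆ U₀ := (closedBall_subset_ball (half_lt_self hε)).trans hball
    have hbU : ball M₀ (ε / 2) ⊆ U₀ := ball_subset_closedBall.trans hcb
    obtain ⟨CR, hCRnn, hCR⟩ := exists_bound_on_closedBall (g := fderiv ℝ cR) hcRfc hcb
    obtain ⟨CR2, -, hCR2⟩ := exists_bound_on_closedBall (g := fderiv ℝ (fderiv ℝ cR)) hcR''c hcb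
    refine ⟨ε / 2, hε2, Cf2 * (2 * Real.exp (T * K) * CR) ^ 2 +
        Cf * (2 * Real.exp (T * K + T * K * Real.exp (T * K)) * CR ^ 2 + 2 * Real.exp (T * K) * CR2),
      hbU, fun ω M hM => ?_⟩
    refine (hF''bound ω M (hbU hM)).trans ?_
    have h1 := hCR M (ball_subset_closedBall hM)
    have h2 := hCR2 M (ball_subset_closedBall hM)
    gcongr
  obtain ⟨hC1h, hfdh⟩ := contDiffOn_one_integral (μ := P) hU₀ (F := F) (F' := F')
    (fun M _ => hFmeas M) (fun M _ => hFint M) hderiv hF'cont hbd1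
  have hF'int : ∀ M ∈ U₀, Integrable (F' M) P := fun M hM =>
    (hasFDerivAt_integral_step (μ := P) hU₀ (F := F) (F' := F') (fun M _ => hFmeas M) (fun M _ => hFint M)
      hderiv hF'cont hbd1 hM).2.2.2
  obtain ⟨hC1h', -⟩ := contDiffOn_one_integral (μ := P) hU₀ (F := F') (F' := F'')
    hF'meas hF'int hderiv2 hF''cont hbd2
  obtain ⟨h, hh⟩ : ∃ h : Cfg → ℝ, h = fun M => ∫ ω, F M ω ∂P := ⟨_, rfl⟩
  have hC2 : ContDiffOn ℝ 2 h U₀ := by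
    rw [hh, show (2 : WithTop ℕ∞) = 1 + 1 from (one_add_one_eq_two).symm]
    refine (contDiffOn_succ_iff_fderiv_of_isOpen (𝕜 := ℝ) (E := Cfg) (F := ℝ) (n := 1)
      (f := fun M => ∫ ω, F M ω ∂P) (s := U₀) hU₀).2
      ⟨hC1h.differentiableOn one_ne_zero, fun h1 => absurd h1 (by simp), ?_⟩
    exact hC1h'.congr fun M hM => hfdh M hM
  -- (11) gluing with the cut-off
  refine ⟨fun M => χ M * h M, contDiff_mul_of_eventuallyEq_zero hU₀ hC2 (contDiff_infty.1 hχs 2) hχ0,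
    fun x => ?_⟩
  have hχ1 : χ (coords x) = 1 := hχx x
  have hR : R (coords x) = x := hRx x
  have hcx : coords x = fun (e : Edge 3 L) (k l : Fin (fundamentalLatticeRep 2).N) =>
      (fundamentalLatticeRep 2).ρ (x e) k l := by rw [hcoords]
  show _ = χ _ * h _
  rw [← hcx, hχ1, one_mul, hh]
  show _ = ∫ ω, F (coords x) ω ∂P
  rw [← integral_congr_ae (hae (coords x)), hR, hcoords]

end Summit.QuantumFields.YangMills.Theorems.ColdStartUniversality

end
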